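import Summits.AtomisticToContinuum.Crystallization.Theses.PalmUnimodularRigidity
import Summits.AtomisticToContinuum.Crystallization.Theorems.PalmUnimodularRigidityMinimiserShellsResidualDefs
import Summits.AtomisticToContinuum.Crystallization.Theorems.MinimiserShells.Negative.Rootedness
import Literature.Probability.Process.PointStationaryLaw
import Literature.MathematicalPhysics.StatisticalMechanics.RootEnergy

/-!
# Cap vocabulary of line `octahedral-annulus-mandate` (crux `MinimiserShells`, stmt-AtomisticToContinuum-9225): DEFINITIONS

Route `PalmUnimodularRigidity`, crux decl
`Summit.AtomisticToContinuum.Crystallization.Theses.PalmUnimodularRigidity.MinimiserShells`, line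
`octahedral-annulus-mandate` (checked skeleton `Cruxes/MinimiserShells/Lines/octahedral_annulus_mandate.lean`,
lead `prover-line-stmt-AtomisticToContinuum-9225-a1-0`).

The skeleton's four registered stubs are stated over a small vocabulary which this file makes importable by
the stub files under `Theorems/` (a Cruxes workfile is not an admissible import there).  Everything is copied
VERBATIM from the checked skeleton; nothing here is a published fact — these are objects the line posits
(D-0016 `…Defs.lean`):

* `IsNNDist μ a` — `a` is the nearest-neighbour distance of the root in the configuration `μ`;
* `meanNorm F` — mean norm of a finite set of vectors;
* `Capped μ` — the line's coarse order parameter (SQUARE-CAPPED ROOT): with `a ∈ [17/20, 21/20]` the root's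
  nearest-neighbour distance, `F` the first shell (atoms `z ≠ 0`, `‖z‖ ≤ 28/25·a`) and `r̄ = meanNorm F`, some
  atom `y` with `6/5·r̄ < ‖y‖ < 8/5·r̄` has at least four atoms of `F` within `28/25·r̄` (it sits over a square
  of the shell, i.e. in an octahedral interstice: Barlow sites have six such caps, tetrahedrally close-packed
  environments none);
* `IsTransfer R M t` — admissible bond transfer: jointly measurable, bounded by `M`, of range `R`;
* `transferDiv t μ` — divergence of the transfer at the root (mass sent minus mass received, the received
  term genuinely re-rooted, `t (θ_y μ) (−y)` with `θ_y μ = μ.map (· − y)`);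
* `caplessMotifCount Q` — number of capless motif sites of a periodic configuration (cap test read in
  `Q.points` re-rooted at the site, `Residual.rerooted`).

Read-back lemmas (sorry-free, from the skeleton): `meanNorm_le`, `capped_of_local`, `capped_congr_of_local`
(**`Capped` is LOCAL at radius `2`**: two measures with the same atoms in `B̄(0, 2)` get the same verdict —
the hypothesis shape of stub `stub_pricingToPeriodic`).
-/

noncomputable section

open MeasureTheory
open scoped ENNReal BigOperators

namespace Summit.AtomisticToContinuum.Crystallization.Theorems.PalmUnimodularRigidityMinimiserShells.Cap

open Literature.MathematicalPhysics.StatisticalMechanics (PeriodicConfiguration)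
open Summit.AtomisticToContinuum.Crystallization.Theorems.MinimiserShells.Negative.Rootedness (E3)
open Summit.AtomisticToContinuum.Crystallization.Theorems.PalmUnimodularRigidityMinimiserShells.Residual (rerooted)

/-! ## Vocabulary of the line -/

/-- `a` is the NEAREST-NEIGHBOUR DISTANCE of the root in the configuration `μ`: some atom `y ≠ 0` has
`‖y‖ = a` and no atom other than the root is closer (the root's own intrinsic scale; not a hard core of
the whole configuration). -/
def IsNNDist (μ : Measure E3) (a : ℝ) : Prop :=
  (∃ y : E3, μ {y} ≠ 0 ∧ y ≠ 0 ∧ ‖y‖ = a) ∧ ∀ y : E3, μ {y} ≠ 0 → y ≠ 0 → a ≤ ‖y‖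

/-- Mean norm of a finite set of vectors (`0` for the empty set, by `x / 0 = 0`). -/
def meanNorm (F : Finset E3) : ℝ := (∑ z ∈ F, ‖z‖) / F.card

/-- **Square-capped root** — the line's coarse order parameter (cap TYPE of the second-kind neighbours,
first-gap / mean-radius normalisation).  With `a ∈ [17/20, 21/20]` the root's nearest-neighbour distance,
`F` the first shell (atoms `z ≠ 0`, `‖z‖ ≤ 28/25·a`) and `r̄ = meanNorm F`: some atom `y` with
`6/5·r̄ < ‖y‖ < 8/5·r̄` has at least four atoms of `F` within `28/25·r̄`.  Barlow sites: six caps at `√2·a`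
over the squares of the (anti)cuboctahedron; TCP sites (Z12 icosahedral, Z14–Z16; A15, C15, σ) and bcc:
none.  The predicate reads only atoms of norm `≤ 2` (`capped_congr_of_local`). -/
def Capped (μ : Measure E3) : Prop :=
  ∃ a : ℝ, 17 / 20 ≤ a ∧ a ≤ 21 / 20 ∧ IsNNDist μ a ∧
    ∃ F : Finset E3, (↑F : Set E3) = {z : E3 | μ {z} ≠ 0 ∧ z ≠ 0 ∧ ‖z‖ ≤ 28 / 25 * a} ∧
      ∃ y : E3, μ {y} ≠ 0 ∧ 6 / 5 * meanNorm F < ‖y‖ ∧ ‖y‖ < 8 / 5 * meanNorm F ∧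
        4 ≤ (F.filter fun z => dist z y ≤ 28 / 25 * meanNorm F).card

/-- **Admissible bond transfer** of range `R` and size `M`: a jointly measurable kernel
`t : (configuration, atom) ↦ ℝ` (mass the root SENDS to its atom `y`), bounded by `M`, vanishing beyond
distance `R`. -/
def IsTransfer (R M : ℝ) (t : Measure E3 → E3 → ℝ) : Prop :=
  Measurable (Function.uncurry t) ∧ (∀ μ y, |t μ y| ≤ M) ∧ ∀ μ y, R < ‖y‖ → t μ y = 0

/-- **Divergence of the transfer at the root**: mass sent minus mass received,
`div t (μ) = ∑_{y ∈ μ} (t(μ, y) − t(θ_y μ, −y))`, `θ_y μ = μ.map (· − y)` (a Bochner integral against `μ`).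
Under every point-stationary law its expectation vanishes (Mecke) — the content of stub `stub_meckePricing`. -/
def transferDiv (t : Measure E3 → E3 → ℝ) (μ : Measure E3) : ℝ :=
  ∫ y, (t μ y - t (Measure.map (fun z => z - y) μ) (-y)) ∂μ

/-- Number of CAPLESS motif sites of a periodic configuration (cap test read in `Q.points` re-rooted at the
site, `Residual.rerooted`). -/
def caplessMotifCount (Q : PeriodicConfiguration 3) : ℕ :=
  Nat.card {x : Q.motif // ¬ Capped (rerooted Q (x : E3))}

/-! ## Locality of the cap predicate -/

/-- The mean norm of a set of vectors of norm `≤ b` (`b ≥ 0`) is `≤ b`. -/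
theorem meanNorm_le {F : Finset E3} {b : ℝ} (hb : 0 ≤ b) (h : ∀ z ∈ F, ‖z‖ ≤ b) :
    meanNorm F ≤ b := by
  unfold meanNorm
  rcases Nat.eq_zero_or_pos F.card with h0 | hpos
  · rw [Finset.card_eq_zero.1 h0]
    simp [hb]
  · have hc : (0 : ℝ) < F.card := by exact_mod_cast hpos
    rw [div_le_iff₀ hc]
    calc ∑ z ∈ F, ‖z‖ ≤ ∑ _z ∈ F, b := Finset.sum_le_sum h
      _ = (F.card : ℝ) * b := by rw [Finset.sum_const, nsmul_eq_mul]
      _ = b * F.card := mul_comm _ _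

/-- One direction of locality: a cap witness for `μ` is a cap witness for any `ν` with the same atoms in
the closed ball of radius `2` (all atoms the predicate reads have norm `≤ 8/5 · 28/25 · 21/20 < 2`). -/
theorem capped_of_local {μ ν : Measure E3}
    (h : ∀ w : E3, ‖w‖ ≤ 2 → (μ {w} ≠ 0 ↔ ν {w} ≠ 0)) : Capped μ → Capped ν := by
  rintro ⟨a, ha1, ha2, ⟨⟨y0, hy0, hy0ne, hy0norm⟩, hmin⟩, F, hF, y, hy, hlo, hhi, hcnt⟩
  have hFle : ∀ z ∈ F, ‖z‖ ≤ 28 / 25 * a := by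
    intro z hz
    have hz' : z ∈ (↑F : Set E3) := hz
    rw [hF] at hz'
    exact hz'.2.2
  have hMle : meanNorm F ≤ 28 / 25 * a := meanNorm_le (by linarith) hFle
  refine ⟨a, ha1, ha2, ⟨⟨y0, ?_, hy0ne, hy0norm⟩, ?_⟩, F, ?_, y, ?_, hlo, hhi, hcnt⟩
  · exact (h y0 (by rw [hy0norm]; linarith)).1 hy0
  · intro z hz hz0
    by_cases hzn : ‖z‖ ≤ 2
    · exact hmin z ((h z hzn).2 hz) hz0
    · push Not at hzn
      linarith
  · rw [hF]
    ext z
    simp only [Set.mem_setOf_eq]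
    constructor
    · rintro ⟨hz, hz0, hzn⟩
      exact ⟨(h z (by linarith)).1 hz, hz0, hzn⟩
    · rintro ⟨hz, hz0, hzn⟩
      exact ⟨(h z (by linarith)).2 hz, hz0, hzn⟩
  · exact (h y (by linarith)).1 hy

/-- **`Capped` is LOCAL at radius `2`**: two measures with the same atoms in `B̄(0, 2)` get the same verdict
(the hypothesis shape of stub `stub_pricingToPeriodic`). -/
theorem capped_congr_of_local {μ ν : Measure E3}
    (h : ∀ w : E3, ‖w‖ ≤ 2 → (μ {w} ≠ 0 ↔ ν {w} ≠ 0)) : Capped μ ↔ Capped ν :=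
  ⟨capped_of_local h, capped_of_local fun w hw => (h w hw).symm⟩

/-- **`Capped` is LOCAL at radius `2`**, closed form (the registered sub-goal `capped_local`; this is the
locality hypothesis of stub `stub_pricingToPeriodic` at `G := Capped`, used by the skeleton's `capGap_of`). -/
theorem capped_local : ∀ μ ν : Measure E3, (∀ w : E3, ‖w‖ ≤ 2 → (μ {w} ≠ 0 ↔ ν {w} ≠ 0)) →
    (Capped μ ↔ Capped ν) :=
  fun _ _ h => capped_congr_of_local h

end Summit.AtomisticToContinuum.Crystallization.Theorems.PalmUnimodularRigidityMinimiserShells.Cap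

end
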